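import Summits.SmoothPoincare4.SmoothPoincare4.Theses.SymplecticOrigami
import Literature.Geometry.Symplectic.SphereProdSymplecticHost

/-!
# Line `stable-seam-host` (crux `OrigamiFoldExistence`, stmt-SmoothPoincare4-7844): the formal host package EXISTS — `(S² × S², σ ⊕ σ)`

Worker A certificate (wave 1 of lead c9), the converse companion of the landed
`helper_hostPackage_of_hostEmbedding` (p141794: the registered STUB 1 `stub_hostEmbedding` FORCES
the bare host package).  Here the bare host package is CONSTRUCTED, so it is no longer a formal
obstruction to STUB 1 (its `S⁴`-instance, the shield `SPC4 ⇒ STUB 1`, and the glue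
`Stabilisation.StabOneSuffices → STUB 1` were all blocked on it):

* `helper_hostPackage_sphereProd` (registered helper, signature = the conclusion of
  `helper_hostPackage_of_hostEmbedding` verbatim) — there IS a closed simply connected symplectic
  `ℝ⁴`-charted 4-manifold `(X, Ω)` carrying an `Ω`-symplectic smoothly embedded round 2-sphere
  `c` with a disjoint homotopic smoothly embedded push-off `c'`: `X = S² × S²` re-charted on `ℝ⁴`
  (`Literature.Geometry.Symplectic.SphereProdFour`, Mathlib's product manifold through the tree's
  `Rechart`), `Ω = σ ⊕ σ` the product of the area forms (tree bricks `SphereAreaForm.lean`,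
  `SphereProdSymplecticForm.lean`, `SphereProdSymplecticHost.lean`; McDuff–Salamon 2017,
  Ex. 3.1.2, §3.1 p. 106, Ex. 10.4.2 (iii)), `c = S² × {q}`, `c' = S² × {-q}`.
* `helper_hostPackage_of_diffeomorph_sphereProd` (registered helper) — the HOST HALF of the glue
  `StabOneSuffices → stub_hostEmbedding`: every `ℝ⁴`-charted `C^∞` manifold `P` with a
  diffeomorphism `P ≃ₘ⟮𝓡 4, (𝓡 2).prod (𝓡 2)⟯ S² × S²` (the output of
  `Summit.SmoothPoincare4.SmoothPoincare4.Theses.Stabilisation.StabOneSuffices`) is Hausdorff,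
  second countable, compact, simply connected and carries the transported package
  `(Φ^*(σ ⊕ σ); Φ⁻¹ ∘ (·, q), Φ⁻¹ ∘ (·, -q))`.  What the glue still lacks is the OTHER half: the
  embedding `J` of a neighbourhood of the fake ball `Δ_e ⊂ Σ` into `P = Σ # S² × S²`, to be
  unpacked from `Literature.Topology.FourManifolds.IsConnectedSum`.

No definitions, no named facts, no `sorry`.
-/

noncomputable section

-- the prescribed namespace `Summit.<P>.<Sub>.…` duplicates `SmoothPoincare4` (P = Sub)
set_option linter.dupNamespace false

open scoped Manifold ContDiff Topology
open Set Function

namespace Summit.SmoothPoincare4.SmoothPoincare4.Theorems.OrigamiFoldExistence.StableSeamHost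

open Literature.Geometry.Symplectic

/-- A point of the round 2-sphere and its antipode are distinct slices' heights: `q₀ ≠ -q₀`.
[folklore] -/
private theorem northPole_ne_neg :
    (⟨EuclideanSpace.single 0 1, by simp⟩ : Metric.sphere (0 : EuclideanSpace ℝ (Fin 3)) 1) ≠
      -⟨EuclideanSpace.single 0 1, by simp⟩ :=
  ne_neg_of_mem_unit_sphere ℝ _

/-- **The host package of line `stable-seam-host` is non-vacuous: `(S² × S², σ ⊕ σ)` charted on
`ℝ⁴`, with the square-zero symplectic sphere `S² × {q}` and its disjoint homotopic push-off
`S² × {-q}`** (signature = the conclusion of `helper_hostPackage_of_hostEmbedding` verbatim; tree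
theorem `Literature.Geometry.Symplectic.sphereProdFour_hostPackage`; McDuff–Salamon 2017,
Example 10.4.2 (iii)). [folklore] -/
theorem helper_hostPackage_sphereProd :
    ∃ (X : Type) (_ : TopologicalSpace X) (_ : T2Space X) (_ : SecondCountableTopology X) (_ : CompactSpace X) (_ : ChartedSpace (EuclideanSpace ℝ (Fin 4)) X) (_ : IsManifold (𝓡 4) ∞ X) (_ : SimplyConnectedSpace X) (Ω : Literature.Geometry.Kaehler.MForm (𝓡 4) X ℝ 2) (c c' : (Metric.sphere (0 : EuclideanSpace ℝ (Fin 3)) 1) → X), (Literature.Geometry.Kaehler.IsSmoothForm Ω ∧ Literature.Geometry.Kaehler.IsClosedForm Ω ∧ ∀ x (v : TangentSpace (𝓡 4) x), v ≠ 0 → ∃ w, Ω x ![v, w] ≠ 0) ∧ (Manifold.IsSmoothEmbedding (𝓡 2) (𝓡 4) ∞ c ∧ (∀ y (v : TangentSpace (𝓡 2) y), v ≠ 0 → ∃ w : TangentSpace (𝓡 2) y, Ω (c y) ![mfderiv (𝓡 2) (𝓡 4) c y v, mfderiv (𝓡 2) (𝓡 4) c y w] ≠ 0) ∧ Manifold.IsSmoothEmbedding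 (𝓡 2) (𝓡 4) ∞ c' ∧ Disjoint (Set.range c) (Set.range c') ∧ ∃ H : unitInterval × (Metric.sphere (0 : EuclideanSpace ℝ (Fin 3)) 1) → X, Continuous H ∧ ∀ y, H (0, y) = c y ∧ H (1, y) = c' y) :=
  ⟨SphereProdFour, inferInstance, inferInstance, inferInstance, inferInstance, inferInstance,
    inferInstance, inferInstance, sphereProdFourForm, sphereProdFourSlice _, sphereProdFourSlice _,
    sphereProdFour_hostPackage northPole_ne_neg⟩

/-- **The host half of the glue `StabOneSuffices → stub_hostEmbedding`**: an `ℝ⁴`-charted `C^∞`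
4-manifold `P` with a diffeomorphism `Φ` onto `S² × S²` (as produced by
`Stabilisation.StabOneSuffices` for `P = Σ # S² × S²`) is Hausdorff, second countable, compact and
simply connected, and carries the host package: the symplectic form `Φ^*(σ ⊕ σ)` with the
`Φ^*(σ ⊕ σ)`-symplectic embedded sphere `Φ⁻¹ ∘ (·, q)` and its disjoint homotopic push-off
`Φ⁻¹ ∘ (·, -q)` (tree theorem `Literature.Geometry.Symplectic.sphereProd_hostPackage_of_diffeomorph`,
point-set transport along the homeomorphism `Φ`; McDuff–Salamon 2017, Example 10.4.2 (iii)). [folklore] -/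
theorem helper_hostPackage_of_diffeomorph_sphereProd :
    ∀ (P : Type) [TopologicalSpace P] [ChartedSpace (EuclideanSpace ℝ (Fin 4)) P] [IsManifold (𝓡 4) ∞ P], Nonempty (P ≃ₘ⟮𝓡 4, (𝓡 2).prod (𝓡 2)⟯ ((Metric.sphere (0 : EuclideanSpace ℝ (Fin 3)) 1) × (Metric.sphere (0 : EuclideanSpace ℝ (Fin 3)) 1))) → ∃ (_ : T2Space P) (_ : SecondCountableTopology P) (_ : CompactSpace P) (_ : SimplyConnectedSpace P) (Ω : Literature.Geometry.Kaehler.MForm (𝓡 4) P ℝ 2) (c c' : (Metric.sphere (0 : EuclideanSpace ℝ (Fin 3)) 1) → P), (Literature.Geometry.Kaehler.IsSmoothForm Ω ∧ Literature.Geometry.Kaehler.IsClosedForm Ω ∧ ∀ x (v : TangentSpace (𝓡 4) x), v ≠ 0 → ∃ w, Ω x ![v, w] ≠ 0) ∧ (Manifold.IsSmoothEmbedding (𝓡 2) (𝓡 4) ∞ c ∧ (∀ y (v : TangentSpace (𝓡 2) y), v ≠ 0 → ∃ w : TangentSpace (𝓡 2) y, Ω (c y) ![mfderiv (𝓡 2)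 (𝓡 4) c y v, mfderiv (𝓡 2) (𝓡 4) c y w] ≠ 0) ∧ Manifold.IsSmoothEmbedding (𝓡 2) (𝓡 4) ∞ c' ∧ Disjoint (Set.range c) (Set.range c') ∧ ∃ H : unitInterval × (Metric.sphere (0 : EuclideanSpace ℝ (Fin 3)) 1) → P, Continuous H ∧ ∀ y, H (0, y) = c y ∧ H (1, y) = c' y) := by
  intro P _ _ _ hΦ
  obtain ⟨Φ⟩ := hΦ
  haveI : Fact (Module.finrank ℝ (EuclideanSpace ℝ (Fin 3)) = 2 + 1) := ⟨finrank_euclideanSpace_fin⟩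
  let e : P ≃ₜ ((Metric.sphere (0 : EuclideanSpace ℝ (Fin 3)) 1) ×
      (Metric.sphere (0 : EuclideanSpace ℝ (Fin 3)) 1)) := Φ.toHomeomorph
  haveI : T2Space P := e.symm.t2Space
  haveI : SecondCountableTopology P := e.secondCountableTopology
  haveI : CompactSpace P := e.symm.compactSpace
  haveI : SimplyConnectedSpace ((Metric.sphere (0 : EuclideanSpace ℝ (Fin 3)) 1) ×
      (Metric.sphere (0 : EuclideanSpace ℝ (Fin 3)) 1)) :=
    Literature.Topology.FourManifolds.SphereProd.simplyConnectedSpace (k := 2) le_rfl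
  haveI : SimplyConnectedSpace P := e.toHomotopyEquiv.simplyConnectedSpace
  exact ⟨inferInstance, inferInstance, inferInstance, inferInstance, hostFormOfDiffeo Φ,
    hostSliceOfDiffeo Φ _, hostSliceOfDiffeo Φ _,
    sphereProd_hostPackage_of_diffeomorph Φ northPole_ne_neg⟩

end Summit.SmoothPoincare4.SmoothPoincare4.Theorems.OrigamiFoldExistence.StableSeamHost

end
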